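import Literature.Geometry.Lorentzian.GreenIdentityCompactSupport
import HarnessLib

/-!
# The distributional equation `Δ_h u − f u = g` read in a chart

Schoen–Yau, Comm. Math. Phys. 65 (1979), proof of Lemma 3.2 (p. 65), pass from the energy
identity to smooth solutions by "standard linear elliptic theory", which is applied in local
coordinates. This file supplies the coordinate form of the *distributional* equation: if a
measurable `u : N → ℝ` on a Riemannian manifold `(N, h)` modelled on `ℝ^m` satisfies
`∫ u (Δ_h ζ − f ζ) dμ_h = ∫ g ζ dμ_h` for all `ζ ∈ C²_c(N)` (the conclusion of
`exists_veryWeakSolution_of_sobolev`, `AFLinearWeakExistence.lean`), then in the extended chart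
`φ` at any point `x`, with Gram matrix `G = (h_{ij})`, the representative `ū = u ∘ φ⁻¹` is a
distributional solution on `φ.target` of the divergence-form equation
`∑ᵢⱼ ∂ⱼ(aᵢⱼ ∂ᵢ ū) − √(det G) (f ∘ φ⁻¹) ū = √(det G) (g ∘ φ⁻¹)`, `aᵢⱼ = √(det G) (G⁻¹)ⱼᵢ`
(`integral_comp_extChartAt_symm_divForm_of_veryWeak`) — exactly the hypothesis of the interior
regularity theorem `exists_contDiffOn_ae_eq_of_divForm_weak` (`DivFormRegularity.lean`).

Ingredients: the zero extension `ζ = 1_{φ.source} (ψ ∘ φ)` of a test function `ψ` compactly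
supported in the chart target is a compactly supported `Cⁿ` function on `N`
(`contMDiff_indicator_comp_extChartAt`, `hasCompactSupport_indicator_comp_extChartAt`); the
divergence form of the coordinate Laplacian, `√g (Δ_h ζ) ∘ φ⁻¹ = ∑ᵢ ∂ᵢ(√g gⁱˡ ∂ₗ ψ)`
(`dalembertian_eq_sum_localFrame`, `coordLaplacian_mul_sqrt_det_eq_sum_fderiv`, as in
`GreenIdentityCompactSupport.lean`); and the chart formula `dμ_h = √g dy`
(`integral_eq_integral_chart`). Everything is proved; no definitions, no named facts.

## References

* R. Schoen, S.-T. Yau, *On the proof of the positive mass conjecture in general relativity*,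
  Comm. Math. Phys. 65 (1979) 45–76, proof of Lemma 3.2 (p. 65). [SchoenYauPMT1979]
* I. Chavel, *Riemannian Geometry: A Modern Introduction*, 2nd ed., CUP 2006, §III.3 (III.3.6),
  §III.7 (the Laplacian in local coordinates). [Chavel2006]
-/

noncomputable section

open Bundle Set Function Filter Manifold MeasureTheory Finset
open scoped Manifold ContDiff Topology Matrix ENNReal

namespace Literature.Geometry.Lorentzian

open PseudoRiemannianMetric

section ZeroExtension

variable {m : ℕ} {H : Type*} [TopologicalSpace H]
  {I : ModelWithCorners ℝ (EuclideanSpace ℝ (Fin m)) H}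
  {N : Type*} [TopologicalSpace N] [ChartedSpace H N]

/-- **Zero extension of a chart pull-back.** For a function `ψ` on the model space with compact
support inside the target of the extended chart `φ` at `x`, the function
`ζ = 1_{source} · (ψ ∘ φ)` on the manifold agrees with `ψ ∘ φ` on the chart domain, vanishes off
the compact set `φ⁻¹(tsupport ψ)`, and `ζ ∘ φ⁻¹ = ψ` on the chart target. [folklore] -/
theorem tsupport_indicator_comp_extChartAt_subset [T2Space N] (x : N) {ψ : EuclideanSpace ℝ (Fin m) → ℝ}
    (hψc : HasCompactSupport ψ) (hψT : tsupport ψ ⊆ (extChartAt I x).target) :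
    tsupport ((chartAt H x).source.indicator (ψ ∘ extChartAt I x)) ⊆
      (extChartAt I x).symm '' tsupport ψ ∧
    IsCompact ((extChartAt I x).symm '' tsupport ψ) ∧
    (extChartAt I x).symm '' tsupport ψ ⊆ (chartAt H x).source := by
  have hsrc : (chartAt H x).source = (extChartAt I x).source := (extChartAt_source I (x := x)).symm
  have hKc : IsCompact ((extChartAt I x).symm '' tsupport ψ) :=
    hψc.isCompact.image_of_continuousOn ((continuousOn_extChartAt_symm x).mono hψT)
  have hKS : (extChartAt I x).symm '' tsupport ψ ⊆ (chartAt H x).source := by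
    rintro _ ⟨y, hy, rfl⟩
    rw [hsrc]
    exact (extChartAt I x).map_target (hψT hy)
  refine ⟨closure_minimal (fun p hp ↦ ?_) hKc.isClosed, hKc, hKS⟩
  rw [mem_support] at hp
  by_cases hps : p ∈ (chartAt H x).source
  · rw [indicator_of_mem hps, Function.comp_apply] at hp
    have hps' : p ∈ (extChartAt I x).source := hsrc ▸ hps
    exact ⟨extChartAt I x p, subset_tsupport _ (mem_support.2 hp), (extChartAt I x).left_inv hps'⟩
  · exact absurd (indicator_of_notMem hps _) hp

/-- The zero extension of `ψ ∘ φ` is `C^n` when `ψ` is `C^n` with compact support in the chart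
target. [folklore] -/
theorem contMDiff_indicator_comp_extChartAt [T2Space N] {n : ℕ∞ω} [IsManifold I n N] (x : N)
    {ψ : EuclideanSpace ℝ (Fin m) → ℝ} (hψ : ContDiff ℝ n ψ) (hψc : HasCompactSupport ψ)
    (hψT : tsupport ψ ⊆ (extChartAt I x).target) :
    ContMDiff I 𝓘(ℝ, ℝ) n ((chartAt H x).source.indicator (ψ ∘ extChartAt I x)) := by
  obtain ⟨hts, -, hKS⟩ := tsupport_indicator_comp_extChartAt_subset (I := I) x hψc hψT
  refine contMDiff_of_tsupport fun p hp ↦ ?_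
  have hps : p ∈ (chartAt H x).source := hKS (hts hp)
  have hev : (chartAt H x).source.indicator (ψ ∘ extChartAt I x) =ᶠ[𝓝 p] ψ ∘ extChartAt I x := by
    filter_upwards [(chartAt H x).open_source.mem_nhds hps] with q hq
    rw [indicator_of_mem hq]
  refine ContMDiffAt.congr_of_eventuallyEq ?_ hev
  exact (hψ.contMDiff.contMDiffAt).comp p
    ((contMDiffOn_extChartAt (I := I) (n := n) (x := x)).contMDiffAt
      ((chartAt H x).open_source.mem_nhds hps))

/-- The zero extension of `ψ ∘ φ` has compact support. [folklore] -/
theorem hasCompactSupport_indicator_comp_extChartAt [T2Space N] (x : N)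
    {ψ : EuclideanSpace ℝ (Fin m) → ℝ} (hψc : HasCompactSupport ψ)
    (hψT : tsupport ψ ⊆ (extChartAt I x).target) :
    HasCompactSupport ((chartAt H x).source.indicator (ψ ∘ extChartAt I x)) := by
  obtain ⟨hts, hKc, -⟩ := tsupport_indicator_comp_extChartAt_subset (I := I) x hψc hψT
  exact hKc.of_isClosed_subset isClosed_closure hts

/-- On the chart target, `ζ ∘ φ⁻¹ = ψ` for the zero extension `ζ` of `ψ ∘ φ`. [folklore] -/
theorem indicator_comp_extChartAt_symm_apply (x : N) (ψ : EuclideanSpace ℝ (Fin m) → ℝ)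
    {y : EuclideanSpace ℝ (Fin m)} (hy : y ∈ (extChartAt I x).target) :
    (chartAt H x).source.indicator (ψ ∘ extChartAt I x) ((extChartAt I x).symm y) = ψ y := by
  have hys : (extChartAt I x).symm y ∈ (chartAt H x).source := by
    rw [← extChartAt_source I]; exact (extChartAt I x).map_target hy
  rw [indicator_of_mem hys, Function.comp_apply, (extChartAt I x).right_inv hy]

end ZeroExtension

section ChartIdentity

variable {m : ℕ} {H : Type*} [TopologicalSpace H]
  {I : ModelWithCorners ℝ (EuclideanSpace ℝ (Fin m)) H} [I.Boundaryless]
  {N : Type*} [TopologicalSpace N] [ChartedSpace H N] [IsManifold I ∞ N]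
  [T2Space N] [LocallyCompactSpace N] [MeasurableSpace N] [BorelSpace N]
  (h : ContMDiffRiemannianMetric I ∞ (EuclideanSpace ℝ (Fin m)) (TangentSpace I : N → Type _))
  [(ofRiemannian h).HasLeviCivita]

/-- **The distributional equation `Δ_h u − f u = g` read in a chart.** Let `(N, h)` be a
Riemannian manifold modelled on `ℝ^m`, `u : N → ℝ` measurable, `f, g` continuous, and suppose
`∫ u (Δ_h ζ − f ζ) dμ_h = ∫ g ζ dμ_h` for all `ζ ∈ C²_c(N)`. Then in the extended chart `φ` at `x`,
with Gram matrix `G(y) = (h_{ij}(y))`, density `√det G` and `aᵢⱼ = √det G · (G⁻¹)ⱼᵢ`, the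
representative `ū = u ∘ φ⁻¹` satisfies, for every smooth `ψ` compactly supported in `φ.target`,
`∫ ū (∑ᵢⱼ ∂ⱼ(aᵢⱼ ∂ᵢψ) − √det G (f ∘ φ⁻¹) ψ) dy = ∫ √det G (g ∘ φ⁻¹) ψ dy`
— the divergence form `√g Δ_h ζ ∘ φ⁻¹ = ∑ᵢ ∂ᵢ(√g gⁱˡ ∂ₗ ψ)` of the coordinate Laplacian
(`coordLaplacian_mul_sqrt_det_eq_sum_fderiv`) applied to the zero extension `ζ` of `ψ ∘ φ`, and the
chart formula `dμ_h = √g dy` (`integral_eq_integral_chart`). Chavel 2006, §III.3 (III.3.6) and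
§III.7 (the Laplacian in local coordinates). [cite: Chavel2006, §III.3 (III.3.6)] -/
theorem integral_comp_extChartAt_symm_divForm_of_veryWeak (x : N) {u : N → ℝ} (hum : Measurable u)
    {f g : N → ℝ} (hf : Continuous f) (hg : Continuous g)
    (hweak : ∀ ζ : N → ℝ, CMDiff 2 ζ → HasCompactSupport ζ →
      ∫ p, u p * ((ofRiemannian h).dalembertian ζ p - f p * ζ p) ∂riemannianMeasure h =
        ∫ p, g p * ζ p ∂riemannianMeasure h)
    {ψ : EuclideanSpace ℝ (Fin m) → ℝ} (hψ : ContDiff ℝ ∞ ψ) (hψc : HasCompactSupport ψ)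
    (hψT : tsupport ψ ⊆ (extChartAt I x).target) :
    ∫ y, u ((extChartAt I x).symm y) *
        ((∑ i, ∑ j, fderiv ℝ (fun z ↦ (Real.sqrt (chartGramMatrix h x z).det *
            (chartGramMatrix h x z)⁻¹ j i) *
            fderiv ℝ ψ z ((EuclideanSpace.basisFun (Fin m) ℝ).toBasis i)) y
            ((EuclideanSpace.basisFun (Fin m) ℝ).toBasis j)) -
          (Real.sqrt (chartGramMatrix h x y).det * f ((extChartAt I x).symm y)) * ψ y) =
      ∫ y, (Real.sqrt (chartGramMatrix h x y).det * g ((extChartAt I x).symm y)) * ψ y := by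
  classical
  -- notation: the standard basis, the chart target, the Gram matrix
  set b : Module.Basis (Fin m) ℝ (EuclideanSpace ℝ (Fin m)) := (EuclideanSpace.basisFun (Fin m) ℝ).toBasis
    with hb_def
  obtain ⟨T, hTdef⟩ : ∃ T : Set (EuclideanSpace ℝ (Fin m)), T = (extChartAt I x).target := ⟨_, rfl⟩
  have hT : IsOpen T := by rw [hTdef]; exact isOpen_extChartAt_target x
  have hTm : MeasurableSet T := hT.measurableSet
  have hsrc : (chartAt H x).source = (extChartAt I x).source :=
    (extChartAt_source (I := I) (x := x)).symm
  have hψT' : tsupport ψ ⊆ T := hTdef ▸ hψT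
  obtain ⟨Gh, hGh⟩ : ∃ Gh : EuclideanSpace ℝ (Fin m) → Fin m → Fin m → ℝ,
      Gh = fun y i j ↦ chartGramMatrix h x y i j := ⟨_, rfl⟩
  have hofG : ∀ y, Matrix.of (Gh y) = chartGramMatrix h x y := fun y ↦ by
    rw [hGh]; rfl
  -- the zero extension `ζ` of `ψ ∘ φ`
  obtain ⟨ζ, hζdef⟩ : ∃ ζ : N → ℝ, ζ = (chartAt H x).source.indicator (ψ ∘ extChartAt I x) :=
    ⟨_, rfl⟩
  have hψ2 : ContDiff ℝ 2 ψ := by exact_mod_cast contDiff_infty.1 hψ 2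
  have hζs : CMDiff 2 ζ := by
    rw [hζdef]
    exact contMDiff_indicator_comp_extChartAt x hψ2 hψc hψT
  have hζc : HasCompactSupport ζ := by
    rw [hζdef]; exact hasCompactSupport_indicator_comp_extChartAt x hψc hψT
  obtain ⟨hts, -, hKS⟩ := tsupport_indicator_comp_extChartAt_subset (I := I) x hψc hψT
  have hζsupp : tsupport ζ ⊆ (extChartAt I x).source := by
    rw [hζdef, ← hsrc]; exact hts.trans hKS
  have hζT : ∀ y ∈ T, ζ ((extChartAt I x).symm y) = ψ y := fun y hy ↦ by
    rw [hζdef]; exact indicator_comp_extChartAt_symm_apply x ψ (hTdef ▸ hy)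
  -- the weak identity for `ζ`
  have hW := hweak ζ hζs hζc
  -- regularity of the metric data on `T`
  have hGT : ∀ y ∈ T, ∀ i j, Gh y i j = (ofRiemannian h).val ((extChartAt I x).symm y)
      ((trivializationAt (EuclideanSpace ℝ (Fin m)) (TangentSpace I) x).localFrame b i
        ((extChartAt I x).symm y))
      ((trivializationAt (EuclideanSpace ℝ (Fin m)) (TangentSpace I) x).localFrame b j
        ((extChartAt I x).symm y)) := by
    intro y hy i j
    rw [hGh]
    exact chartGramMatrix_apply_eq_val_localFrame h x (hTdef ▸ hy) i j
  have hGsm : ∀ i j, ContDiffOn ℝ ∞ (fun y ↦ Gh y i j) T := fun i j ↦ by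
    rw [hTdef]
    exact (contDiffOn_gram_comp_extChartAt_symm b (ofRiemannian h) i j).congr
      (fun y hy ↦ hGT y (hTdef ▸ hy) i j)
  have hGpi : ContDiffOn ℝ ∞ Gh T :=
    contDiffOn_pi.2 fun i ↦ contDiffOn_pi.2 fun j ↦ hGsm i j
  have hGsym : ∀ z i j, Gh z i j = Gh z j i := fun z i j ↦ by
    rw [hGh]; exact chartGramMatrix_apply_comm h x z i j
  have hdetpos : ∀ y ∈ T, 0 < (Matrix.of (Gh y)).det := fun y hy ↦ by
    rw [hofG]
    exact Real.sqrt_pos.1 (sqrt_det_chartGramMatrix_pos h x (hTdef ▸ hy))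
  have hGdet : ContDiffOn ℝ ∞ (fun y ↦ (Matrix.of (Gh y)).det) T := by
    intro y hy
    have h1 := contMDiffAt_matrix_det (I := 𝓘(ℝ, EuclideanSpace ℝ (Fin m))) (k := ∞)
      (A := fun y ↦ Matrix.of (Gh y)) (x₀ := y)
      (fun i j ↦ contMDiffAt_iff_contDiffAt.2 ((hGsm i j).contDiffAt (hT.mem_nhds hy)))
    exact (contMDiffAt_iff_contDiffAt.1 h1).contDiffWithinAt
  have hρ : ContDiffOn ℝ ∞ (fun y ↦ Real.sqrt (Matrix.of (Gh y)).det) T :=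
    hGdet.sqrt fun y hy ↦ (hdetpos y hy).ne'
  have hGinv : ∀ i l, ContDiffOn ℝ ∞ (fun y ↦ (Matrix.of (Gh y))⁻¹ i l) T := by
    intro i l y hy
    have h1 := contMDiffAt_matrix_inv (I := 𝓘(ℝ, EuclideanSpace ℝ (Fin m))) (k := ∞)
      (A := fun y ↦ Matrix.of (Gh y)) (x₀ := y)
      (fun i j ↦ contMDiffAt_iff_contDiffAt.2 ((hGsm i j).contDiffAt (hT.mem_nhds hy)))
      (hdetpos y hy).ne' i l
    exact (contMDiffAt_iff_contDiffAt.1 h1).contDiffWithinAt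
  -- the coefficients `a i j = √g G⁻¹ j i` and the fluxes `W j = ∑ᵢ a i j ∂ᵢψ`
  obtain ⟨a, ha⟩ : ∃ a : Fin m → Fin m → EuclideanSpace ℝ (Fin m) → ℝ,
      a = fun i j z ↦ Real.sqrt (Matrix.of (Gh z)).det * (Matrix.of (Gh z))⁻¹ j i := ⟨_, rfl⟩
  have haT : ∀ i j, ContDiffOn ℝ ∞ (a i j) T := fun i j ↦ by
    rw [ha]; exact hρ.mul (hGinv j i)
  obtain ⟨W, hWdef⟩ : ∃ W : Fin m → EuclideanSpace ℝ (Fin m) → ℝ, W = fun i y ↦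
      Real.sqrt (Matrix.of (Gh y)).det * ∑ l, (Matrix.of (Gh y))⁻¹ i l * fderiv ℝ ψ y (b l) :=
    ⟨_, rfl⟩
  have hWa : ∀ j, W j = fun z ↦ ∑ i, a i j z * fderiv ℝ ψ z (b i) := by
    intro j
    rw [hWdef, ha]
    funext z
    dsimp only
    rw [Finset.mul_sum]
    refine Finset.sum_congr rfl fun i _ ↦ ?_
    ring
  have hdψ : ∀ l, ContDiff ℝ ∞ (fun y ↦ fderiv ℝ ψ y (b l)) := fun l ↦
    (hψ.fderiv_right (m := ∞) (by exact_mod_cast le_top)).clm_apply contDiff_const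
  have hmemS : ∀ y ∈ T, (extChartAt I x).symm y ∈ (chartAt H x).source := fun y hy ↦ by
    rw [hsrc]; exact (extChartAt I x).map_target (hTdef ▸ hy)
  have hright : ∀ y ∈ T, extChartAt I x ((extChartAt I x).symm y) = y := fun y hy ↦
    (extChartAt I x).right_inv (hTdef ▸ hy)
  have hTnhds : ∀ y ∈ T, T ∈ 𝓝 y := fun y hy ↦ hT.mem_nhds hy
  -- (1) the Laplacian of `ζ` in the chart, in divergence form: `√g Δζ ∘ φ⁻¹ = ∑ᵢ ∂ᵢ Wᵢ` on `T`
  have hΔ : ∀ y ∈ T, Real.sqrt (Matrix.of (Gh y)).det *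
      (ofRiemannian h).dalembertian ζ ((extChartAt I x).symm y) = ∑ i, fderiv ℝ (W i) y (b i) := by
    intro y hy
    have hGy : HasFDerivAt Gh (fderiv ℝ Gh y) y :=
      ((hGpi.contDiffAt (hTnhds y hy)).differentiableAt (by simp)).hasFDerivAt
    have hf2y : HasFDerivAt (fun z ↦ fderiv ℝ ψ z) (fderiv ℝ (fderiv ℝ ψ) y) y :=
      (((hψ2.fderiv_right (m := 1) (by norm_num)).contDiffAt).differentiableAt
        one_ne_zero).hasFDerivAt
    have hL := dalembertian_eq_sum_localFrame (ofRiemannian h) b (hmemS y hy)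
      (hζs ((extChartAt I x).symm y)) (Gh := Gh) (fh := ψ) (by
        rw [hright y hy]
        filter_upwards [hTnhds y hy] with z hz
        exact hGT z hz) (by
        rw [hright y hy]
        filter_upwards [hTnhds y hy] with z hz
        rw [Function.comp_apply, hζT z hz])
    rw [hright y hy] at hL
    have hC := Literature.Analysis.Calculus.coordLaplacian_mul_sqrt_det_eq_sum_fderiv b hGy hGsym
      (hdetpos y hy) hf2y
    rw [hL]
    simp only [Literature.Analysis.Calculus.fderiv_apply_apply_eq hGy] at hC ⊢
    rw [hC, hWdef]
  -- (2) `∑ⱼ ∂ⱼ Wⱼ = ∑ᵢⱼ ∂ⱼ(a i j ∂ᵢψ)` on `T`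
  have hdiv : ∀ y ∈ T, ∑ j, fderiv ℝ (W j) y (b j) =
      ∑ i, ∑ j, fderiv ℝ (fun z ↦ a i j z * fderiv ℝ ψ z (b i)) y (b j) := by
    intro y hy
    rw [Finset.sum_comm]
    refine Finset.sum_congr rfl fun j _ ↦ ?_
    rw [hWa j, fderiv_fun_sum fun i _ ↦ ?_]
    · simp only [FunLike.coe_sum, Finset.sum_apply]
    · exact (((haT i j).contDiffAt (hTnhds y hy)).differentiableAt (by simp)).mul
        ((hdψ i).differentiable (by simp) y)
  -- (3) the left-hand side in the chart
  haveI : IsFiniteMeasureOnCompacts (riemannianMeasure h) :=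
    ⟨fun K hK ↦ riemannianVolume_lt_top_of_isCompact_holds h le_rfl hK⟩
  have hΔc : Continuous ((ofRiemannian h).dalembertian ζ) := continuous_dalembertian _ hζs
  have hζcont : Continuous ζ := hζs.continuous
  have hsuppL : support (fun p ↦ u p * ((ofRiemannian h).dalembertian ζ p - f p * ζ p)) ⊆
      (extChartAt I x).source := by
    intro p hp
    rw [mem_support] at hp
    have hp' : (ofRiemannian h).dalembertian ζ p - f p * ζ p ≠ 0 := right_ne_zero_of_mul hp
    refine hζsupp (by_contra fun hnot ↦ hp' ?_)
    rw [dalembertian_eq_zero_of_notMem_tsupport _ hnot, image_eq_zero_of_notMem_tsupport hnot,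
      mul_zero, sub_zero]
  have hLHS : ∫ p, u p * ((ofRiemannian h).dalembertian ζ p - f p * ζ p) ∂riemannianMeasure h =
      ∫ y in T, u ((extChartAt I x).symm y) *
        ((∑ i, ∑ j, fderiv ℝ (fun z ↦ a i j z * fderiv ℝ ψ z (b i)) y (b j)) -
          (Real.sqrt (Matrix.of (Gh y)).det * f ((extChartAt I x).symm y)) * ψ y) := by
    have hmeas : Measurable (fun p ↦ u p * ((ofRiemannian h).dalembertian ζ p - f p * ζ p)) :=
      hum.mul (hΔc.sub (hf.mul hζcont)).measurable
    rw [integral_eq_integral_chart h x hmeas hsuppL, ← hTdef]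
    refine setIntegral_congr_fun hTm (fun y hy ↦ ?_)
    rw [smul_eq_mul, ← hofG, hζT y hy, ← hdiv y hy, ← hΔ y hy]
    ring
  -- (4) the right-hand side in the chart
  have hsuppR : support (fun p ↦ g p * ζ p) ⊆ (extChartAt I x).source := by
    intro p hp
    rw [mem_support] at hp
    exact hζsupp (subset_tsupport _ (right_ne_zero_of_mul hp))
  have hRHS : ∫ p, g p * ζ p ∂riemannianMeasure h =
      ∫ y in T, (Real.sqrt (Matrix.of (Gh y)).det * g ((extChartAt I x).symm y)) * ψ y := by
    have hmR : Measurable (fun p ↦ g p * ζ p) := (hg.mul hζcont).measurable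
    rw [integral_eq_integral_chart h x hmR hsuppR, ← hTdef]
    refine setIntegral_congr_fun hTm (fun y hy ↦ ?_)
    rw [smul_eq_mul, ← hofG, hζT y hy]
    ring
  -- (5) both target integrands vanish off `tsupport ψ ⊆ T`
  have hvan : ∀ y ∉ T, ∀ i j, fderiv ℝ (fun z ↦ a i j z * fderiv ℝ ψ z (b i)) y (b j) = 0 := by
    intro y hy i j
    have hy' : y ∉ tsupport ψ := fun h' ↦ hy (hψT' h')
    have hev : (fun z ↦ a i j z * fderiv ℝ ψ z (b i)) =ᶠ[𝓝 y] fun _ ↦ 0 := by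
      have h0 : ∀ᶠ z in 𝓝 y, z ∉ tsupport ψ :=
        (isClosed_tsupport ψ).isOpen_compl.mem_nhds hy'
      filter_upwards [h0] with z hz
      have : z ∉ tsupport (fderiv ℝ ψ) := fun h' ↦ hz (tsupport_fderiv_subset ℝ h')
      rw [image_eq_zero_of_notMem_tsupport this, zero_apply, mul_zero]
    rw [hev.fderiv_eq, fderiv_const_apply, zero_apply]
  have hψ0 : ∀ y ∉ T, ψ y = 0 := fun y hy ↦
    image_eq_zero_of_notMem_tsupport fun h' ↦ hy (hψT' h')
  rw [hLHS, hRHS] at hW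
  rw [setIntegral_eq_integral_of_forall_compl_eq_zero (s := T) (fun y hy ↦ by
      simp only [hvan y hy, Finset.sum_const_zero, hψ0 y hy, mul_zero, sub_zero]),
    setIntegral_eq_integral_of_forall_compl_eq_zero (s := T) (fun y hy ↦ by
      rw [hψ0 y hy, mul_zero])] at hW
  rw [ha] at hW
  simpa only [hofG] using hW

end ChartIdentity

end Literature.Geometry.Lorentzian
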